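import Literature.Geometry.Riemannian.CanonicalNeighbourhoodTheorem
import Literature.Geometry.Riemannian.CkCaps
import HarnessLib

/-!
# Chen–Zhu's canonical neighbourhood theorem (2006, Thm. 4.1 / §5) at PRINTED strength:
# canonical neighbourhoods with `C^{[1/ε]}` necks and caps
(topic `Geometry/Riemannian`)

Cite item `wi-28846` (route SmoothPoincare4/ChangGurskyYang, crux stmt-SmoothPoincare4-10834, line
neck-exclusion: registered stub `stub_ckDichotomy`; also the vocabulary the PIC line
`hamilton_chen_tang_zhu` RF4/RF5 ultimately needs). The tree's `HasCanonicalNeighbourhood` /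
`chenZhu_canonicalNeighbourhoodTheorem` / `chenZhu_aprioriAssumptions_smoothSolution`
(`CanonicalNeighbourhoods.lean`, `CanonicalNeighbourhoodTheorem.lean`) vendor Chen–Zhu's canonical
neighbourhood assumption with **`C⁰` necks and caps** — explicitly flagged there as "WEAKER than
print in the `C⁰` neck closeness only" and "to be split along these lines when the §3 vocabulary
exists". The `C^{[ε⁻¹]}` vocabulary now exists (`IsCkEpsNeck`, `IsCkStrongEpsNeck` in
`CkNecks.lean`; `IsCkEpsCap` in `CkCaps.lean`), and this file restates the three declarations at
the PRINTED strength, changing nothing but alternatives (a) and (b):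

* DEFINITION `HasCkCanonicalNeighbourhood g cov S x t ε C₁ C₂ η` — verbatim
  `HasCanonicalNeighbourhood` with (a) `IsCkStrongEpsNeck 3 g S B t R(x,t) ε` (Chen–Zhu 2006, §5,
  p. 26 (a): "`ε`-close (in `C^{[ε⁻¹]}` topology) to the corresponding subset of the evolving
  standard round cylinder") and (b) `IsCkEpsCap (g t) (cov t) B ε` (§4, p. 24, caps whose ends are
  `ε`-necks of §2, p. 4, "in `C^{[ε⁻¹]}` topology"); (c), the ball sandwich, the curvature
  comparison, the gradient estimates and the volume bounds unchanged. API: `mono_C₁`, `exists_mem`,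
  and the extraction `HasCkCanonicalNeighbourhood.dichotomy` — either `(M, g t)` contains a
  `C^{[1/ε]}` `ε`-neck (cases (a): `IsCkStrongEpsNeck.isCkEpsNeck`; (b):
  `IsCkEpsCap.exists_isCkEpsNeck`) or `x` lies in a compact open set with positive curvature
  operator (case (c)).
* NAMED FACT `chenZhu_ckCanonicalNeighbourhoodTheorem` — **Theorem 4.1 (p. 19) in the form used in
  §5 (p. 26)**, verbatim `chenZhu_canonicalNeighbourhoodTheorem` (same hypotheses, constants and
  quantifier pattern: `η` universal; `∃ ε₀ ∀ 0 < ε ≤ ε₀ ∃ C₁ C₂`; `r₀` depending on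
  `ε, κ, θ, ρ, Λ, P` and the final-time bound `T₁`; closed simply connected `M⁴`) with the
  conclusion `HasCkCanonicalNeighbourhood`. This is the statement the printed Theorem 4.1 asserts
  (its conclusion is `C^{[ε⁻¹]}`-closeness to an ancient `κ`-solution, whose canonical
  neighbourhoods, Thm. 3.8, are `C^{[ε⁻¹]}` necks and caps); the `C⁰` fact is its shadow. Not
  proved here (Perelman's Thm. 12.1 scheme; see the status note in
  `CanonicalNeighbourhoodTheorem.lean`).
* PROVED `chenZhu_ckAprioriAssumptions_of_ckCanonicalNeighbourhoodTheorem` — **the sentence of §5,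
  p. 26** ("It follows from Lemma 2.1 and Theorem 4.1 that the a priori assumptions above hold for
  the smooth solution on `[0, T₀)`") at printed strength: the `C^k` Theorem 4.1, Perelman's no local
  collapsing theorem I (`perelman_noLocalCollapsing`), Lemma 2.1 (`hamilton_chenZhu_pinching`) and
  the preservation of PIC (`ricciFlow_preserves_positiveIsotropicCurvature`) imply the canonical
  neighbourhood assumption with `C^{[1/ε]}` necks and caps for the smooth maximal solution — the
  proof of `chenZhu_aprioriAssumptions_smoothSolution_of_canonicalNeighbourhoodTheorem'` carried
  over verbatim (bounded curvature on `M × [0, 1]` by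
  `IsRicciFlow.exists_scalarCurvatureWith_le_of_lt`). Stated as a theorem with the four named facts
  as hypotheses (no new named fact for the a priori assumptions).
* PROVED `chenZhu_ckDichotomy_of_ckCanonicalNeighbourhoodTheorem` — the consequence the
  neck-exclusion line registered as `stub_ckDichotomy`, VERBATIM its statement, from the same four
  facts: for all `0 < ε ≤ ε₀`, every maximal Ricci flow with `T > 1` and PIC initial metric on a
  closed simply connected `M⁴` has `r > 0` such that every `(x, t)` with `R(x,t) ≥ r⁻²` sees a
  `C^{[1/ε]}` `ε`-neck in `(M, g t)` or lies in a compact open set of positive curvature operator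
  (Borel structure `borel M`; a uniform threshold `r = r(T)` from the non-increasing `r(·)`).

## References

* B.-L. Chen, X.-P. Zhu, *Ricci flow with surgery on four-manifolds with positive isotropic
  curvature*, J. Differential Geom. 74 (2006) 177–264 (arXiv:math/0504478, read: chunks 19, 24,
  26): Thm. 4.1 (p. 19); §5, p. 26 (canonical neighborhood assumption (a)–(c), and "It follows
  from Lemma 2.1 and Theorem 4.1 …"); §2, p. 4 (`ε`-necks in `C^{[ε⁻¹]}`); §4, p. 24 (`ε`-caps);
  Thm. 3.8 (p. 17), Prop. 3.6 (p. 16). [ChenZhu2006]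
* R. S. Hamilton, *Four-manifolds with positive isotropic curvature*, Comm. Anal. Geom. 5 (1997)
  1–92: §3.2 (C2), p. 31 (`C^k` closeness (A), (B)); §2.1, Thm. 1.9 and remark (p. 13). [Hamilton1997]
* G. Perelman, *The entropy formula for the Ricci flow and its geometric applications* (2002),
  Thm. 4.1, Thm. 12.1. [Perelman2002]
-/

noncomputable section

open Bundle Set Metric Function TopologicalSpace
open scoped Manifold ContDiff Topology ENNReal

namespace Literature.Geometry.Riemannian

open Lorentzian Lorentzian.PseudoRiemannianMetric

universe u

/-- Local notation: `𝔼 n` is the model Euclidean space `EuclideanSpace ℝ (Fin n)`. -/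
local notation "𝔼 " n:arg => EuclideanSpace ℝ (Fin n)

/-! ### Canonical neighbourhoods with `C^{[1/ε]}` necks and caps (Chen–Zhu 2006, §5, p. 26) -/

section Canonical

variable {M : Type*} [TopologicalSpace M] [ChartedSpace (𝔼 4) M] [IsManifold (𝓡 4) ∞ M]
  [T3Space M] [MeasurableSpace M] [BorelSpace M]

open MeasureTheory in
/-- **`(x, t)` has a canonical neighbourhood with accuracy `ε` and constants `C₁, C₂, η`, with
`C^{[1/ε]}` necks and caps** — Chen–Zhu's canonical neighbourhood assumption (2006, §5, arXiv
p. 26) at PRINTED strength, for the flow `(g, cov)` on the time set `S`. Writing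
`R(y, s) = scalarCurvatureWith (g s) (cov s) y`, `B_t(x, r)` for the geodesic balls of `g t` and
`Vol_t` for its Riemannian volume: there are an open `B ⊆ M` and `σ` with
`0 < σ < C₁ R(x,t)^{-1/2}` and `B_t(x, σ) ⊆ B ⊆ B_t(x, 2σ)` such that
* (a) "`B` is a strong `ε`-neck … `ε`-close (in `C^{[ε⁻¹]}` topology) to the corresponding subset
  of the evolving standard round cylinder `S³ × ℝ` with scalar curvature `1` at the time zero" at
  scale `R(x,t)` (`IsCkStrongEpsNeck 3`, `CkNecks.lean`) with `(C₂ R(x,t))⁻² ≤ Vol_t(B)`, or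
  (b) "`B` is an `ε`-cap" of `(M, g t)` in the `C^{[ε⁻¹]}` topology (`IsCkEpsCap`, `CkCaps.lean`;
  §4, p. 24 with the necks of §2, p. 4) with `(C₂ R(x,t))⁻² ≤ Vol_t(B)`, or (c) "`B` is a compact
  four-manifold with positive curvature operator" (`HasPositiveCurvatureOperatorOn`);
* "the scalar curvature in `B` at time `t` is between `C₂⁻¹ R(x,t)` and `C₂ R(x,t)`";
* the gradient estimates (5.4) "`|∇R| < η R^{3/2}` and `|∂R/∂t| < η R²`" at the points of `B` at
  time `t`.
Verbatim the `C⁰` template `HasCanonicalNeighbourhood` (`CanonicalNeighbourhoods.lean`) except for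
the neck and cap predicates of (a), (b).
[cite: ChenZhu2006, §5, p. 26 (canonical neighborhood assumption (a)–(c)); §2, p. 4; §4, p. 24] -/
def HasCkCanonicalNeighbourhood
    (g : ℝ → PseudoRiemannianMetric (𝓡 4) ∞ (𝔼 4) (TangentSpace (𝓡 4) : M → Type _))
    (cov : ℝ → CovariantDerivative (𝓡 4) (𝔼 4) (TangentSpace (𝓡 4) : M → Type _))
    (S : Set ℝ) (x : M) (t ε C₁ C₂ η : ℝ) : Prop :=
  ∃ (B : Opens M) (σ : ℝ),
    0 < σ ∧ σ < C₁ / Real.sqrt ((g t).scalarCurvatureWith (cov t) x) ∧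
    (g t).ball x (ENNReal.ofReal σ) ⊆ (B : Set M) ∧
    (B : Set M) ⊆ (g t).ball x (ENNReal.ofReal (2 * σ)) ∧
    ((IsCkStrongEpsNeck 3 g S (B : Set M) t ((g t).scalarCurvatureWith (cov t) x) ε ∧
        ENNReal.ofReal ((C₂ * (g t).scalarCurvatureWith (cov t) x)⁻¹ ^ 2) ≤ (g t).vol B) ∨
      (IsCkEpsCap (g t) (cov t) B ε ∧
        ENNReal.ofReal ((C₂ * (g t).scalarCurvatureWith (cov t) x)⁻¹ ^ 2) ≤ (g t).vol B) ∨
      (IsCompact (B : Set M) ∧ HasPositiveCurvatureOperatorOn (g t) (cov t) B)) ∧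
    (∀ y ∈ (B : Set M),
      C₂⁻¹ * (g t).scalarCurvatureWith (cov t) x ≤ (g t).scalarCurvatureWith (cov t) y ∧
        (g t).scalarCurvatureWith (cov t) y ≤ C₂ * (g t).scalarCurvatureWith (cov t) x) ∧
    (∀ y ∈ (B : Set M),
      Real.sqrt ((g t).gradSq (fun z ↦ (g t).scalarCurvatureWith (cov t) z) y) <
          η * ((g t).scalarCurvatureWith (cov t) y *
            Real.sqrt ((g t).scalarCurvatureWith (cov t) y)) ∧
        |derivWithin (fun s ↦ (g s).scalarCurvatureWith (cov s) y) S t| <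
          η * (g t).scalarCurvatureWith (cov t) y ^ 2)

variable {g : ℝ → PseudoRiemannianMetric (𝓡 4) ∞ (𝔼 4) (TangentSpace (𝓡 4) : M → Type _)}
  {cov : ℝ → CovariantDerivative (𝓡 4) (𝔼 4) (TangentSpace (𝓡 4) : M → Type _)}
  {S : Set ℝ} {x : M} {t ε C₁ C₁' C₂ η : ℝ}

/-- A canonical neighbourhood persists under enlarging `C₁` (only the upper bound on `σ`
involves it). [folklore] -/
theorem HasCkCanonicalNeighbourhood.mono_C₁ (h : HasCkCanonicalNeighbourhood g cov S x t ε C₁ C₂ η)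
    (hC : C₁ ≤ C₁') : HasCkCanonicalNeighbourhood g cov S x t ε C₁' C₂ η := by
  obtain ⟨B, σ, hσ, hσC, h1, h2, h3, h4, h5⟩ := h
  refine ⟨B, σ, hσ, hσC.trans_le ?_, h1, h2, h3, h4, h5⟩
  exact div_le_div_of_nonneg_right hC (Real.sqrt_nonneg _)

/-- The centre belongs to its canonical neighbourhood (`x ∈ B_t(x, σ) ⊆ B`, `σ > 0`). [folklore] -/
theorem HasCkCanonicalNeighbourhood.exists_mem (h : HasCkCanonicalNeighbourhood g cov S x t ε C₁ C₂ η) :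
    ∃ B : Opens M, x ∈ B ∧ (B : Set M) ⊆ (g t).ball x (ENNReal.ofReal (2 * C₁ /
      Real.sqrt ((g t).scalarCurvatureWith (cov t) x))) := by
  obtain ⟨B, σ, hσ, hσC, h1, h2, -⟩ := h
  refine ⟨B, h1 (PseudoRiemannianMetric.mem_ball_self x (by simpa using hσ)), h2.trans ?_⟩
  refine PseudoRiemannianMetric.ball_mono _ _ (ENNReal.ofReal_le_ofReal ?_)
  rw [mul_div_assoc]
  exact mul_le_mul_of_nonneg_left hσC.le zero_le_two

/-- **The dichotomy read off a canonical neighbourhood**: either `(M, g t)` contains an `ε`-neck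
in the `C^{[1/ε]}` topology — in case (a) the time-`t` slice of the strong neck
(`IsCkStrongEpsNeck.isCkEpsNeck`), in case (b) a neck inside the cap, which exists because a cap
`≅ 𝔹⁴ / ℝℙ⁴ ∖ 𝔹̄⁴` is not compact (`IsCkEpsCap.exists_isCkEpsNeck`) — or, case (c), `x` lies in a
compact open set on which `g t` has positive curvature operator.
[cite: ChenZhu2006, §5, p. 26 (canonical neighborhood assumption (a)–(c))] -/
theorem HasCkCanonicalNeighbourhood.dichotomy (h : HasCkCanonicalNeighbourhood g cov S x t ε C₁ C₂ η) :
    (∃ (N : Set M) (r' : ℝ), IsCkEpsNeck 3 (g t) N ε r') ∨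
      (∃ B : Set M, IsOpen B ∧ IsCompact B ∧ x ∈ B ∧
        HasPositiveCurvatureOperatorOn (g t) (cov t) B) := by
  obtain ⟨B, σ, hσ, -, h1, -, h3, -, -⟩ := h
  have hxB : x ∈ (B : Set M) := h1 (PseudoRiemannianMetric.mem_ball_self x (by simpa using hσ))
  rcases h3 with ⟨hneck, -⟩ | ⟨hcap, -⟩ | ⟨hcpt, hpco⟩
  · exact Or.inl ⟨B, _, hneck.isCkEpsNeck⟩
  · obtain ⟨N, r', -, hN⟩ := hcap.exists_isCkEpsNeck
    exact Or.inl ⟨N, r', hN⟩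
  · exact Or.inr ⟨B, B.isOpen, hcpt, hxB, hpco⟩

end Canonical

/-! ### Theorem 4.1 in the form used in §5, printed strength (named fact) -/

/-- NAMED FACT (**Chen–Zhu 2006, Theorem 4.1**, arXiv p. 19, in the form used in §5, p. 26, **with
`C^{[1/ε]}` necks and caps**). Printed: "Given `ε > 0`, `κ > 0`, `0 < θ, ρ, Λ, P < +∞`, one can
find `r₀ > 0` with the following property. If `g_ij(x,t)`, `t ∈ [0, T)` with `T > 1`, is a solution
to the Ricci flow on a four-dimensional manifold `M⁴` with no essential incompressible space form,
which has positive isotropic curvature, is `κ`-noncollapsed on the scales `≤ θ` and satisfies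
(2.1), (2.2) and (2.3) in Lemma 2.1, then for any point `(x₀, t₀)` with `t₀ ≥ 1` and
`Q = R(x₀, t₀) ≥ r₀⁻²`, the solution in the parabolic region … is, after scaling by the factor
`Q`, `ε`-close (in `C^{[ε⁻¹]}`-topology) to the corresponding subset of some ancient `κ`-solution
with restricted isotropic curvature pinching. Consequently each [such] point … satisfies the
gradient estimates (4.1) … and has a canonical neighborhood `B` with
`B_{t₀}(x₀, r) ⊂ B ⊂ B_{t₀}(x₀, 2r)` for some `0 < r < C₁(ε) R(x₀,t₀)^{-1/2}`, which is either an
evolving `ε`-neck, or an evolving `ε`-cap, or a compact four-manifold with positive curvature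
operator"; used on p. 26 in the vocabulary of the canonical neighbourhood assumption ((a) strong
`ε`-neck in `C^{[ε⁻¹]}`, (b) `ε`-cap, (c) compact with positive curvature operator, curvature
between `C₂⁻¹R` and `C₂R`, gradient estimates with a universal `η` — Prop. 3.6 —, volume bounds
`(C₂R)⁻² ≤ Vol_t(B)` in cases (a), (b) — Thm. 3.8). **Vended form**: VERBATIM the tree's
`chenZhu_canonicalNeighbourhoodTheorem` (`CanonicalNeighbourhoodTheorem.lean` — see its docstring
for the word-by-word justification of every hypothesis, in particular the explicit final-time bound
`T ≤ T₁` used by Step 2 of the printed proof, p. 22, and `of_uniform` there: the literal one-`r₀`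
form implies it) with the conclusion `HasCkCanonicalNeighbourhood` — alternatives (a), (b) in the
PRINTED `C^{[ε⁻¹]}` topology (`IsCkStrongEpsNeck 3`, `IsCkEpsCap`) instead of their `C⁰` shadows.
Quantifiers: `η > 0` universal; `0 < ε ≤ ε₀` ("for any sufficiently small `ε > 0`", JDG p. 220);
`C₁, C₂ > 0` depending on `ε` only; `r₀ > 0` depending on `ε, κ, θ, ρ, Λ, P, T₁`; `M : Type u` a
closed simply connected 4-manifold (no essential incompressible space form, vacuously) with any
Borel structure; `(g, cov)` a Ricci flow of Riemannian PIC metrics on `[0, T)`, `1 < T ≤ T₁`,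
`κ`-noncollapsed on scales `≤ θ`, pinched as in Lemma 2.1 with constants `ρ, Λ, P`. Users take
`(h : chenZhu_ckCanonicalNeighbourhoodTheorem)`.
[cite: ChenZhu2006, Thm. 4.1 (p. 19; proof Step 2, p. 22), with Thm. 3.8 (p. 17) and Prop. 3.6 (p. 16); §5, p. 26]
[cite: Hamilton1997, §3.2 (C2), p. 31; §2.1, Thm. 1.9 and remark (p. 13)] -/
def chenZhu_ckCanonicalNeighbourhoodTheorem : Prop :=
  ∃ η : ℝ, 0 < η ∧ ∃ ε₀ : ℝ, 0 < ε₀ ∧ ∀ ε : ℝ, 0 < ε → ε ≤ ε₀ → ∃ C₁ C₂ : ℝ, 0 < C₁ ∧ 0 < C₂ ∧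
    ∀ κ θ ρ Λ P T₁ : ℝ, 0 < κ → 0 < θ → 0 < ρ → 0 < Λ → 0 < P → ∃ r₀ : ℝ, 0 < r₀ ∧
      ∀ (M : Type u) [TopologicalSpace M] [T2Space M] [SecondCountableTopology M] [CompactSpace M]
        [ChartedSpace (EuclideanSpace ℝ (Fin 4)) M] [IsManifold (𝓡 4) ∞ M] [SimplyConnectedSpace M]
        [MeasurableSpace M] [BorelSpace M]
        (g : ℝ → PseudoRiemannianMetric (𝓡 4) ∞ (EuclideanSpace ℝ (Fin 4))
          (TangentSpace (𝓡 4) : M → Type _))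
        (cov : ℝ → CovariantDerivative (𝓡 4) (EuclideanSpace ℝ (Fin 4))
          (TangentSpace (𝓡 4) : M → Type _)) (T : ℝ),
        IsRicciFlow g cov (Ico 0 T) → (∀ t ∈ Ico 0 T, (g t).IsRiemannian) → 1 < T → T ≤ T₁ →
        (∀ t ∈ Ico 0 T, (g t).HasPositiveIsotropicCurvature) →
        (∀ r : ℝ, 0 < r → r ≤ θ → IsKappaNoncollapsed g cov (Ico 0 T) κ r) →
        (∀ t ∈ Ico 0 T, ∀ (x : M) (e : Fin 4 → TangentSpace (𝓡 4) x),
          (g t).IsOrthonormalFrame x e →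
            Matrix.PinchedBy ((g t).blockA (cov t) x e) ((g t).blockB (cov t) x e)
                ((g t).blockC (cov t) x e) ρ Λ ∧
              Matrix.ImprovedPinchingAt ((g t).blockA (cov t) x e) ((g t).blockB (cov t) x e)
                ((g t).blockC (cov t) x e) ρ Λ P t) →
        ∀ t ∈ Ico 0 T, 1 ≤ t → ∀ x : M,
          r₀⁻¹ ^ 2 ≤ (g t).scalarCurvatureWith (cov t) x →
            HasCkCanonicalNeighbourhood g cov (Ico 0 T) x t ε C₁ C₂ η

/-! ### The a priori assumptions of the smooth solution at printed strength (proved reduction) -/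

/-- **"It follows from Lemma 2.1 and Theorem 4.1 that the a priori assumptions above hold for the
smooth solution on `[0, T₀)`"** (Chen–Zhu 2006, §5, arXiv p. 26) — at PRINTED strength
(`C^{[1/ε]}` necks and caps), PROVED from the four named facts the sentence quotes: Theorem 4.1 in
the `C^k` form (`chenZhu_ckCanonicalNeighbourhoodTheorem`), Perelman's no local collapsing
theorem I as used on p. 19 (`perelman_noLocalCollapsing`), Lemma 2.1 (`hamilton_chenZhu_pinching`)
and the preservation of PIC (Hamilton 1997, Thm. B1.2, `ricciFlow_preserves_positiveIsotropicCurvature`);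
the bounded curvature of the smooth solution on `M × [0, 1]` (the silent step covering `t < 1`) is
the theorem `IsRicciFlow.exists_scalarCurvatureWith_le_of_lt`. Conclusion: the canonical
neighbourhood assumption with accuracy `ε` for the smooth maximal solution — verbatim the body of
`chenZhu_aprioriAssumptions_smoothSolution` with `HasCkCanonicalNeighbourhood`: `η` universal,
`0 < ε ≤ ε₀`, `C₁, C₂` depending on `ε` only; for `M` closed simply connected, `(g, cov)` a maximal
Ricci flow on `[0, T)` with `T > 1` and PIC initial metric, a positive non-increasing `r` on
`[0, ∞)` such that every `(x, t)`, `t ∈ [0, T)`, with `R(x,t) ≥ r(t)⁻²` has a `C^k` canonical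
neighbourhood. Proof verbatim that of
`chenZhu_aprioriAssumptions_smoothSolution_of_canonicalNeighbourhoodTheorem'`: Perelman gives `κ`
(scales `< √T`, `θ := 1 < √T`), Lemma 2.1 gives `ρ, Λ, P`, Thm. B1.2 gives PIC along the flow,
Thm. 4.1 (with `T₁ := T`) gives `r₀`; with `K ≥ R` on `M × [0, 1]`, `r := min (r₀, (K⁺ + 1)^{-1/2})`
is a positive constant, no point of `[0, 1)` has `R ≥ r⁻² > K`, and for `t ≥ 1`, `r⁻² ≥ r₀⁻²`.
[cite: ChenZhu2006, §5, p. 26] -/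
theorem chenZhu_ckAprioriAssumptions_of_ckCanonicalNeighbourhoodTheorem
    (h41 : chenZhu_ckCanonicalNeighbourhoodTheorem.{0})
    (hP : perelman_noLocalCollapsing.{0, 0, 0})
    (hL : hamilton_chenZhu_pinching.{0})
    (hPIC : ricciFlow_preserves_positiveIsotropicCurvature.{0}) :
    ∃ η : ℝ, 0 < η ∧ ∃ ε₀ : ℝ, 0 < ε₀ ∧ ∀ ε : ℝ, 0 < ε → ε ≤ ε₀ → ∃ C₁ C₂ : ℝ, 0 < C₁ ∧ 0 < C₂ ∧
      ∀ (M : Type) [TopologicalSpace M] [T2Space M] [SecondCountableTopology M] [CompactSpace M]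
        [ChartedSpace (EuclideanSpace ℝ (Fin 4)) M] [IsManifold (𝓡 4) ∞ M] [SimplyConnectedSpace M]
        [MeasurableSpace M] [BorelSpace M]
        (g : ℝ → PseudoRiemannianMetric (𝓡 4) ∞ (EuclideanSpace ℝ (Fin 4))
          (TangentSpace (𝓡 4) : M → Type _))
        (cov : ℝ → CovariantDerivative (𝓡 4) (EuclideanSpace ℝ (Fin 4))
          (TangentSpace (𝓡 4) : M → Type _)) (T : ℝ),
        IsMaximalRicciFlow g cov T → 1 < T → (g 0).HasPositiveIsotropicCurvature →
          ∃ r : ℝ → ℝ, (∀ t ∈ Ici (0 : ℝ), 0 < r t) ∧ AntitoneOn r (Ici 0) ∧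
            ∀ t ∈ Ico 0 T, ∀ x : M,
              (r t)⁻¹ ^ 2 ≤ (g t).scalarCurvatureWith (cov t) x →
                HasCkCanonicalNeighbourhood g cov (Ico 0 T) x t ε C₁ C₂ η := by
  obtain ⟨η, hη, ε₀, hε₀, H⟩ := h41
  refine ⟨η, hη, ε₀, hε₀, fun ε hε hεε₀ ↦ ?_⟩
  obtain ⟨C₁, C₂, hC₁, hC₂, H⟩ := H ε hε hεε₀
  refine ⟨C₁, C₂, hC₁, hC₂, ?_⟩
  intro M _ _ _ _ _ _ _ _ _ g cov T hmax hT hpic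
  -- Perelman: `κ`-noncollapsing on all scales `< √T`, in particular on scales `≤ 1 < √T`
  obtain ⟨κ, hκ, hnc⟩ := hP (𝓡 4) M T hmax.pos g cov hmax.isRicciFlow hmax.isRiemannian
  have hsqrt : (1 : ℝ) < Real.sqrt T := (Real.lt_sqrt zero_le_one).2 (by simpa using hT)
  have hnc' : ∀ r : ℝ, 0 < r → r ≤ 1 → IsKappaNoncollapsed g cov (Ico 0 T) κ r :=
    fun r hr hr1 ↦ hnc r hr (hr1.trans_lt hsqrt)
  -- Lemma 2.1: pinching with constants depending on the initial metric
  obtain ⟨ρ, Λ, P, hρ, hΛ, hP', hpinch⟩ := hL M (g 0) (hmax.isRiemannian 0 hmax.zero_mem) hpic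
  have hpinch' := hpinch T g cov hmax.isRicciFlow hmax.isRiemannian rfl
  -- Theorem B1.2: positive isotropic curvature along the flow
  have hPIC' := hPIC M T g cov hmax.isRicciFlow hmax.isRiemannian hpic
  -- Theorem 4.1 (`C^k` form) with `θ = 1` and the final-time bound `T₁ = T`
  obtain ⟨r₀, hr₀, H41⟩ := H κ 1 ρ Λ P T hκ one_pos hρ hΛ hP'
  -- bounded scalar curvature on `M × [0, 1]`
  obtain ⟨K, hK⟩ := hmax.isRicciFlow.exists_scalarCurvatureWith_le_of_lt hT
  -- the (constant) threshold function
  set r₁ : ℝ := min r₀ (Real.sqrt (max K 0 + 1))⁻¹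
  have hsqrtK : 0 < Real.sqrt (max K 0 + 1) := Real.sqrt_pos.2 (by positivity)
  have hr₁ : 0 < r₁ := lt_min hr₀ (inv_pos.2 hsqrtK)
  refine ⟨fun _ ↦ r₁, fun _ _ ↦ hr₁, fun _ _ _ _ _ ↦ le_rfl, ?_⟩
  intro t ht x hR
  have hR' : r₁⁻¹ ^ 2 ≤ (g t).scalarCurvatureWith (cov t) x := hR
  by_cases ht1 : 1 ≤ t
  · -- late times: Theorem 4.1 applies since `r₁ ≤ r₀`
    refine H41 M g cov T hmax.isRicciFlow hmax.isRiemannian hT le_rfl hPIC' hnc' hpinch' t ht ht1 x ?_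
    calc r₀⁻¹ ^ 2 ≤ r₁⁻¹ ^ 2 := by
          gcongr
          exact min_le_left _ _
      _ ≤ (g t).scalarCurvatureWith (cov t) x := hR'
  · -- early times: `R ≤ K < r₁⁻²`, so the hypothesis is void
    exfalso
    have htI : t ∈ Icc (0 : ℝ) 1 := ⟨ht.1, (not_le.1 ht1).le⟩
    have h1 : (g t).scalarCurvatureWith (cov t) x ≤ K := hK t htI x
    have h2 : Real.sqrt (max K 0 + 1) ≤ r₁⁻¹ := by
      rw [le_inv_comm₀ hsqrtK hr₁]
      exact min_le_right _ _
    have h3 : max K 0 + 1 ≤ r₁⁻¹ ^ 2 := by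
      calc max K 0 + 1 = Real.sqrt (max K 0 + 1) ^ 2 := (Real.sq_sqrt (by positivity)).symm
        _ ≤ r₁⁻¹ ^ 2 := by gcongr
    have h4 : K ≤ max K 0 := le_max_left _ _
    linarith

/-! ### The `C^{[1/ε]}` dichotomy at points of large curvature (the form line neck-exclusion consumes) -/

/-- **The `C^{[1/ε]}` canonical-neighbourhood dichotomy** (Chen–Zhu 2006, Thm. 4.1 + §5, p. 26,
read through `HasCkCanonicalNeighbourhood.dichotomy`), PROVED from the four named facts above,
VERBATIM the registered stub `stub_ckDichotomy` of line neck-exclusion (crux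
stmt-SmoothPoincare4-10834): for all sufficiently small accuracies `0 < ε ≤ ε₀`, every maximal
Ricci flow on a closed simply connected 4-manifold with `T > 1` and PIC initial metric admits
`r > 0` such that every `(x, t)`, `t ∈ [0, T)`, with `R(x,t) ≥ r⁻²` EITHER sees an `ε`-neck of
`(M, g t)` in the `C^{[1/ε]}` topology (alternatives (a), (b)) OR lies in a compact open set on
which `g t` has positive curvature operator (alternative (c)). The volumes are taken for the Borel
structure `borel M`; the uniform threshold is `r := r(T)` for the non-increasing positive `r(·)` of
the a priori assumptions (`r(t) ≥ r(T)` for `t ≤ T`). [cite: ChenZhu2006, Thm. 4.1 (p. 19); §5, p. 26] -/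
theorem chenZhu_ckDichotomy_of_ckCanonicalNeighbourhoodTheorem
    (h41 : chenZhu_ckCanonicalNeighbourhoodTheorem.{0})
    (hP : perelman_noLocalCollapsing.{0, 0, 0})
    (hL : hamilton_chenZhu_pinching.{0})
    (hPIC : ricciFlow_preserves_positiveIsotropicCurvature.{0}) :
    ∃ ε₀ : ℝ, 0 < ε₀ ∧ ∀ ε : ℝ, 0 < ε → ε ≤ ε₀ →
      ∀ (M : Type) [TopologicalSpace M] [T2Space M] [SecondCountableTopology M] [CompactSpace M]
        [ChartedSpace (EuclideanSpace ℝ (Fin 4)) M] [IsManifold (𝓡 4) ∞ M] [SimplyConnectedSpace M]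
        (g : ℝ → PseudoRiemannianMetric (𝓡 4) ∞ (EuclideanSpace ℝ (Fin 4))
          (TangentSpace (𝓡 4) : M → Type _))
        (cov : ℝ → CovariantDerivative (𝓡 4) (EuclideanSpace ℝ (Fin 4))
          (TangentSpace (𝓡 4) : M → Type _)) (T : ℝ),
        IsMaximalRicciFlow g cov T → 1 < T → (g 0).HasPositiveIsotropicCurvature →
        ∃ r : ℝ, 0 < r ∧ ∀ t ∈ Ico 0 T, ∀ x : M,
          r⁻¹ ^ 2 ≤ (g t).scalarCurvatureWith (cov t) x →
            (∃ (N : Set M) (r' : ℝ), IsCkEpsNeck 3 (g t) N ε r') ∨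
            (∃ B : Set M, IsOpen B ∧ IsCompact B ∧ x ∈ B ∧
              HasPositiveCurvatureOperatorOn (g t) (cov t) B) := by
  obtain ⟨η, -, ε₀, hε₀, H⟩ :=
    chenZhu_ckAprioriAssumptions_of_ckCanonicalNeighbourhoodTheorem h41 hP hL hPIC
  refine ⟨ε₀, hε₀, fun ε hε hεε₀ ↦ ?_⟩
  obtain ⟨C₁, C₂, -, -, H⟩ := H ε hε hεε₀
  intro M _ _ _ _ _ _ _ g cov T hmax hT hpic
  letI : MeasurableSpace M := borel M
  haveI : BorelSpace M := ⟨rfl⟩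
  obtain ⟨r, hrpos, hranti, Hr⟩ := H M g cov T hmax hT hpic
  have hT0 : (0 : ℝ) ≤ T := (zero_lt_one.trans hT).le
  refine ⟨r T, hrpos T hT0, fun t ht x hR ↦ ?_⟩
  have hrt : r T ≤ r t := hranti (show t ∈ Ici (0 : ℝ) from ht.1) (show T ∈ Ici (0 : ℝ) from hT0)
    ht.2.le
  have hRt : (r t)⁻¹ ^ 2 ≤ (g t).scalarCurvatureWith (cov t) x := by
    have hinv : (r t)⁻¹ ≤ (r T)⁻¹ := inv_anti₀ (hrpos T hT0) hrt
    calc (r t)⁻¹ ^ 2 ≤ (r T)⁻¹ ^ 2 := pow_le_pow_left₀ (inv_nonneg.2 (hrpos t ht.1).le) hinv 2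
      _ ≤ (g t).scalarCurvatureWith (cov t) x := hR
  exact (Hr t ht x hRt).dichotomy

end Literature.Geometry.Riemannian
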